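import Mathlib
import Summits.Ventures.DiscreteObjects.Mahler.DobrowolskiLemma
import Summits.Ventures.DiscreteObjects.Mahler.UnimodularRootReciprocal

/-!
# A lower bound for an integer polynomial evaluated at an algebraic number (venture `DiscreteObjects`, target L)

Cell `pub-namedobj`, seat `pub-namedobj-mahler` (gen 10). Framing: lottery ticket; floor = certified
bounds/negative ranges.

[McKee–Smyth, *Around the Unit Circle*, Thm 1.21]: given `Q ∈ ℤ[z]` of degree `e` and an algebraic
number `α` of degree `d` (minimal polynomial `f ∈ ℤ[z]`, Mahler measure `M(α) = M(f)`), either `Q(α) = 0`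
or
`|Q(α)| ≥ max(1, |α|)^e / (L^{d-1} M(α)^e)`, `L = L(Q) = ∑ |q_i|` (1.7).

Kernel route: the resultant `Res(f, Q) = a^e ∏_{f(β)=0} Q(β)` is a nonzero integer (a common root would
make the irreducible `f` divide `Q`, `dvd_of_aeval_eq_zero_of_irreducible`), so
`1 ≤ |a|^e |Q(α)| ∏_{β ≠ α} |Q(β)| ≤ |Q(α)| · L^{d-1} · (|a| ∏_{β ≠ α} max(1,|β|))^e`
and `|a| ∏_{β ≠ α} max(1,|β|) = M(f)/max(1,|α|)` (`norm_eval_le_length_mul`, gen 8).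

* `resultant_ne_zero_of_irreducible_of_not_dvd` — `Res(f, Q) ≠ 0` when the irreducible `f` does not divide `Q`;
* `liouville_mahler_inequality` — **Thm 1.21**.
-/

namespace Summit.Ventures.DiscreteObjects.Mahler

open Polynomial

/-- If `f ∈ ℤ[X]` is irreducible of positive degree and `f ∤ Q`, then `Res(f, Q) ≠ 0` (no common
complex root). -/
theorem resultant_ne_zero_of_irreducible_of_not_dvd {f Q : ℤ[X]} (hirr : Irreducible f)
    (hd : 1 ≤ f.natDegree) (hndvd : ¬ f ∣ Q) {e : ℕ} (he : Q.natDegree ≤ e) :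
    f.resultant Q f.natDegree e ≠ 0 := by
  intro h
  have hinj : Function.Injective (Int.castRingHom ℂ) := (Int.castRingHom ℂ).injective_int
  have hC := resultant_intCast_eq (f := f) (G := Q) he
  rw [h, Int.cast_zero] at hC
  have hlc : (f.map (Int.castRingHom ℂ)).leadingCoeff ≠ 0 := by
    rw [Ne, leadingCoeff_eq_zero, Polynomial.map_eq_zero_iff hinj]
    exact hirr.ne_zero
  rcases mul_eq_zero.mp hC.symm with h1 | h2
  · exact hlc (pow_eq_zero_iff'.mp h1).1
  · rw [Multiset.prod_eq_zero_iff, Multiset.mem_map] at h2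
    obtain ⟨β, hβmem, hβ0⟩ := h2
    have hβf : aeval β f = 0 := aeval_eq_zero_of_mem_roots_map hβmem
    have hβQ : aeval β Q = 0 := by rwa [← algebraMap_int_eq, eval_map_algebraMap] at hβ0
    exact hndvd (dvd_of_aeval_eq_zero_of_irreducible hirr hd hβf hβQ)

/-- **[McKee–Smyth, Thm 1.21] (Liouville-type inequality).**  Let `f ∈ ℤ[X]` be irreducible of degree
`d ≥ 1` with complex root `α`, and `Q ∈ ℤ[X]` of degree `≤ e` with `Q(α) ≠ 0`.  Then
`|Q(α)| ≥ max(1,|α|)^e / (L(Q)^{d-1} · M(f)^e)`, `L(Q) = ∑_{i ≤ e} |q_i|`. -/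
theorem liouville_mahler_inequality {f : ℤ[X]} (hirr : Irreducible f) (hd : 1 ≤ f.natDegree)
    {α : ℂ} (hα : aeval α f = 0) {Q : ℤ[X]} {e : ℕ} (he : Q.natDegree ≤ e) (hQα : aeval α Q ≠ 0) :
    max 1 ‖α‖ ^ e / ((∑ i ∈ Finset.range (Q.natDegree + 1), (|Q.coeff i| : ℝ)) ^ (f.natDegree - 1) *
      intMahlerMeasure f ^ e) ≤ ‖aeval α Q‖ := by
  classical
  have hf : f ≠ 0 := hirr.ne_zero
  have hinj : Function.Injective (Int.castRingHom ℂ) := (Int.castRingHom ℂ).injective_int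
  set d := f.natDegree with hdd
  set fc := f.map (Int.castRingHom ℂ) with hfc
  set Qc := Q.map (Int.castRingHom ℂ) with hQc
  set R := fc.roots with hR
  set L : ℝ := ∑ i ∈ Finset.range (Q.natDegree + 1), (|Q.coeff i| : ℝ) with hL
  have hQ0 : Q ≠ 0 := by rintro rfl; exact hQα (map_zero _)
  have hL1 : 1 ≤ L := one_le_length hQ0
  have hL0 : 0 < L := by linarith
  have hfc0 : fc ≠ 0 := (Polynomial.map_ne_zero_iff hinj).mpr hf
  have hαR : α ∈ R := by
    rw [hR, mem_roots hfc0, IsRoot.def, hfc, ← algebraMap_int_eq, eval_map_algebraMap]; exact hα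
  have hevalQ : ∀ β : ℂ, Qc.eval β = aeval β Q := by
    intro β; rw [hQc, ← algebraMap_int_eq, eval_map_algebraMap]
  -- the resultant is a nonzero integer
  have hndvd : ¬ f ∣ Q := by
    rintro ⟨T, hT⟩
    exact hQα (by rw [hT, map_mul, hα, zero_mul])
  have hres := resultant_ne_zero_of_irreducible_of_not_dvd hirr hd hndvd he
  have h1 : (1 : ℝ) ≤ ‖((f.resultant Q d e : ℤ) : ℂ)‖ := by
    rw [Complex.norm_intCast]
    exact_mod_cast Int.one_le_abs hres
  rw [resultant_intCast_eq (f := f) (G := Q) he, norm_mul, norm_pow] at h1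
  have hmp := map_multiset_prod (normHom : ℂ →*₀ ℝ) ((R.map Qc.eval))
  rw [Multiset.map_map] at hmp
  simp only [normHom_apply, Function.comp_def] at hmp
  rw [← hfc, ← hR, hmp, ← Multiset.cons_erase hαR, Multiset.map_cons, Multiset.prod_cons] at h1
  -- per-root bound on the other roots
  set R' := R.erase α with hR'
  have hcardR : Multiset.card R = d := by
    have hsp := (IsAlgClosed.splits fc).natDegree_eq_card_roots
    rw [hfc, natDegree_map_eq_of_injective hinj] at hsp
    rw [hR, hfc]; exact hsp.symm
  have hcardR' : Multiset.card R' = d - 1 := by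
    rw [hR', Multiset.card_erase_of_mem hαR, hcardR]; rfl
  have hprod : (R'.map fun β => ‖Qc.eval β‖).prod ≤ L ^ (d - 1) * (R'.map fun β => max 1 ‖β‖).prod ^ e := by
    calc (R'.map fun β => ‖Qc.eval β‖).prod ≤ (R'.map fun β => L * max 1 ‖β‖ ^ e).prod := by
          refine Multiset.prod_map_le_prod_map₀ _ _ (fun β _ => norm_nonneg _) (fun β _ => ?_)
          refine (norm_eval_le_length_mul Q β).trans ?_
          exact mul_le_mul_of_nonneg_left (pow_le_pow_right₀ (le_max_left _ _) he) hL0.le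
      _ = L ^ (d - 1) * (R'.map fun β => max 1 ‖β‖).prod ^ e := by
          rw [Multiset.prod_map_mul, Multiset.prod_map_pow, Multiset.map_const', Multiset.prod_replicate,
            hcardR']
  -- the Mahler measure
  have hM : intMahlerMeasure f = ‖fc.leadingCoeff‖ * (max 1 ‖α‖ * (R'.map fun β => max 1 ‖β‖).prod) := by
    unfold intMahlerMeasure
    rw [mahlerMeasure_eq_leadingCoeff_mul_prod_roots, ← hfc, ← hR, ← Multiset.cons_erase hαR,
      Multiset.map_cons, Multiset.prod_cons]
  have hM0 : 0 < intMahlerMeasure f := by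
    unfold intMahlerMeasure; exact mahlerMeasure_pos_of_ne_zero hfc0
  have hm1 : 0 < max 1 ‖α‖ := lt_of_lt_of_le one_pos (le_max_left _ _)
  have hP0 : 0 ≤ (R'.map fun β => max 1 ‖β‖).prod :=
    Multiset.prod_nonneg (fun x hx => by
      obtain ⟨β, _, rfl⟩ := Multiset.mem_map.mp hx; positivity)
  -- assemble: `1 ≤ ‖Q α‖ · L^{d-1} · (M / max(1,‖α‖))^e`
  have hkey : 1 ≤ ‖aeval α Q‖ * (L ^ (d - 1) * intMahlerMeasure f ^ e) / max 1 ‖α‖ ^ e := by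
    rw [le_div_iff₀ (pow_pos hm1 e), one_mul]
    calc max 1 ‖α‖ ^ e = max 1 ‖α‖ ^ e * 1 := (mul_one _).symm
      _ ≤ max 1 ‖α‖ ^ e * (‖fc.leadingCoeff‖ ^ e * (‖Qc.eval α‖ * (R'.map fun β => ‖Qc.eval β‖).prod)) :=
          mul_le_mul_of_nonneg_left h1 (pow_nonneg hm1.le e)
      _ ≤ max 1 ‖α‖ ^ e * (‖fc.leadingCoeff‖ ^ e *
            (‖Qc.eval α‖ * (L ^ (d - 1) * (R'.map fun β => max 1 ‖β‖).prod ^ e))) := by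
          gcongr
      _ = ‖aeval α Q‖ * (L ^ (d - 1) * intMahlerMeasure f ^ e) := by
          rw [hevalQ α, hM, mul_pow, mul_pow]; ring
  have hden : 0 < L ^ (d - 1) * intMahlerMeasure f ^ e := by positivity
  rw [div_le_iff₀ hden]
  have h2 := hkey
  rw [le_div_iff₀ (pow_pos hm1 e), one_mul] at h2
  linarith

end Summit.Ventures.DiscreteObjects.Mahler
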